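import Literature.MathematicalPhysics.QuantumFieldTheory.Balaban1983to89.T3OSLawNontrivial
import HarnessLib

/-!
# `Balaban1983to89.T3LimitLawAtomless` — under K1 ∧ K2 the continuum loop law of `SU(2)` YM₃ on a three-torus gives every simple-loop variable a
# CONTINUOUS (ATOMLESS) DISTRIBUTION: `ν{y | y_C = a} = 0` for every `a` and every once-visiting label `C`

Cell `ym3-torus` (HUMAN RULING D-0037, YM ladder rung R3), seat `ym3-torus-p2` gen 15 (HOME/IR-NODE.md §21; companion of `T3NontrivialityFromTilt*`,
`T3OSLawNontrivial`).  WHAT THIS IS NOT: not d = 4, not infinite volume, not a mass gap, not Clay; `UnitTiltTail` (K1 ∧ K2, the route's three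
load-bearing cruxes) is an OPEN hypothesis; `SU(2)` and the printed averaging.

THE POINT.  `T3OSLawNontrivial` proved `Var_ν(x_C) > 0` (the limit marginal is not a point mass).  Weak limits need not preserve absolute
continuity, but King's additive Cauchy device controls EVENTS two-sidedly: for every measurable unit-field event `S` and `K ≥ K₀`,
`|μ_K(S) − μ_{K₀}(S)| ≤ Σ_{k ≥ K₀}(8r_k + 4w_k + 2w′_k)` (`T3TailTransfer.integral_unitLaw_sub_le_sum` on the indicator).  With the portmanteau
inequality for the open window `{|y_C − a| < δ}` (through a continuous tent function on the compact cube), the atomlessness of every unit law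
along `C` (`T3NontrivialityFromTiltLabels`), `δ → 0` and then `K₀ → ∞`: **the limit law has NO ATOM at any value of `x_C`** — the continuum
plaquette / Polyakov / simple-loop variable has a continuous distribution function.  (Two-point or lattice-valued limit marginals, which positive
variance alone does not exclude, are ruled out.)

* §1 `integral_comp_avgObs_refine` — the refinement identity for a function of ONE observable (the one-label form of `T3ThresholdRemoval.expectAt_refine`).
* §2 `measureReal_unitLaw_le_add_tail` (King's device on events); the tent window function is built inside §3's proof.
* §3 **`limitLaw_apply_level_eq_zero_of_refine_unitTiltTail`** and the packaged `exists_osLaw_atomless_of_refine_unitTiltTail`.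

References: C. King, CMP 102 (1986) 649–677 [King1986] (Thm 3.4 (3.13) p.657); A. Jaffe, E. Witten [JaffeWittenClay2006] (§6.5 p.11);
S. Chatterjee [Chatterjee2019YMProbabilists] (§6 p.19); T. Bałaban [Balaban1987RG1] ((0.4)/(0.11) p.253).
-/

noncomputable section

open MeasureTheory Filter Topology ProbabilityTheory Set BoundedContinuousFunction
open scoped NNReal ENNReal
open Literature.MathematicalPhysics.QuantumFieldTheory.Balaban1983to89
open Literature.MathematicalPhysics.QuantumFieldTheory.Balaban1983to89.Missing
open Literature.MathematicalPhysics.QuantumFieldTheory.Balaban1983to89.T4Continuum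
open Literature.MathematicalPhysics.QuantumFieldTheory.Balaban1983to89.T4LimitLaw
open Literature.MathematicalPhysics.QuantumFieldTheory.Balaban1983to89.T3ContinuumYM3Torus
open Literature.MathematicalPhysics.QuantumFieldTheory.Balaban1983to89.T3ThresholdRemoval
open Literature.MathematicalPhysics.QuantumFieldTheory.Balaban1983to89.T3LevelShift
open Literature.MathematicalPhysics.QuantumFieldTheory.Balaban1983to89.T3UnitScaleTilt
open Literature.MathematicalPhysics.QuantumFieldTheory.Balaban1983to89.T3TailTransfer
open Literature.MathematicalPhysics.QuantumFieldTheory.Balaban1983to89.T3UnitLawDensityEML (ℰp measurableE_ℰp)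
open Literature.MathematicalPhysics.QuantumFieldTheory.Balaban1983to89.T3NontrivialityFromTilt
open Literature.MathematicalPhysics.QuantumFieldTheory.Balaban1983to89.T3NontrivialityFromTiltRefine
open Literature.MathematicalPhysics.QuantumFieldTheory.Balaban1983to89.T3NontrivialityFromTiltLabels
open Literature.MathematicalPhysics.QuantumFieldTheory.Balaban1983to89.T3OSLawNontrivial

namespace Literature.MathematicalPhysics.QuantumFieldTheory.Balaban1983to89.T3LimitLawAtomless

/-! ## §1 The refinement identity for a function of one observable -/

section RefineOne

variable (F : T3Family) (n : ℕ) {G : Type*} [GaugeGroup G] [MeasurableSpace G] [HaarData G] [RegularGaugeGroup G]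
  (ℰ : LoopAverage G) (hE : ℰ.MeasurableE)

/-- **ONE-OBSERVABLE REFINEMENT IDENTITY**: for measurable `g : ℝ → ℝ`, the Gibbs integral of `g(W̄_C)` at step `K + n` of `F` is the refined family's
unit-law integral of `g ∘ coarseObs F n ℰ [C]` at step `K` (same lattice, same Wilson weight; `T3ThresholdRemoval.avgObs_refine`). [cite: Balaban1987RG1, (0.11) p.253] -/
theorem integral_comp_avgObs_refine {γ : ℝ} (hγ : 0 ≤ γ) (K : ℕ) (C : ULoop3 F) {g : ℝ → ℝ} (hg : Measurable g) :
    ∫ U, g (F.avgObs ℰ (K + n) C U) ∂T4GenFunBounds.gibbsMeasure (F.P (K + n)) ((F.scheme ℰ γ).β (K + n)) =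
      ∫ u, g (coarseObs F n ℰ [C] u) ∂(F.refine n).unitLaw ℰ hE (γ * ((F.L : ℝ)⁻¹) ^ n) K := by
  have hβ : 0 ≤ (F.scheme ℰ γ).β (K + n) := F.scheme_β_nonneg ℰ hγ (K + n)
  have hcs : ∀ u : GaugeField ((F.refine n).P 0) 0 G,
      coarseObs F n ℰ [C] u = F.avgObs ℰ n C (fieldShift (sitesPerDir_refine_unit F n) u) := fun u => by
    simp [coarseObs]
  have hmeas : Measurable fun u : GaugeField ((F.refine n).P 0) 0 G => g (coarseObs F n ℰ [C] u) :=
    hg.comp (measurable_coarseObs F n ℰ hE [C])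
  calc ∫ U, g (F.avgObs ℰ (K + n) C U) ∂T4GenFunBounds.gibbsMeasure (F.P (K + n)) ((F.scheme ℰ γ).β (K + n))
      = ∫ U, g (F.avgObs ℰ (K + n) C U) ∂T4GenFunBounds.gibbsMeasure (F.PP F.m (K + n)) ((F.scheme ℰ γ).β (K + n)) := rfl
    _ = ∫ V, g (F.avgObs ℰ (K + n) C (fieldShift (sitesPerDir_refine_zero F n K) V))
          ∂T4GenFunBounds.gibbsMeasure (F.PP (F.m + n) K) ((F.scheme ℰ γ).β (K + n)) :=
        (integral_gibbsMeasure_comp_fieldShift (sitesPerDir_refine_zero F n K) hβ _).symm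
    _ = ∫ V, g (coarseObs F n ℰ [C] (unitShift (F.refine n) K
          (Averaging.iter (fun j => BlockAveraging.blockAvg (P := F.PP (F.m + n) K) (j := j) ℰ) K V)))
          ∂T4GenFunBounds.gibbsMeasure (F.PP (F.m + n) K) ((F.scheme ℰ γ).β (K + n)) := by
        simp only [hcs, avgObs_refine]
    _ = ∫ u, g (coarseObs F n ℰ [C] u) ∂(F.refine n).unitLaw ℰ hE (γ * ((F.L : ℝ)⁻¹) ^ n) K := by
        rw [integral_unitLaw hE K hmeas, T3Family.refine_β]
        rfl

end RefineOne

/-! ## §2 The window function on the cube; King's device on events -/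

section Window

variable {F : T3Family}

/-- `tent ≤ 𝟙{|t − a| < δ}` as a function of the coordinate value (`δ > 0`). [folklore] -/
private theorem tentFun_le_indicator {a δ : ℝ} (hδ : 0 < δ) (t : ℝ) :
    max 0 (1 - |t - a| / δ) ≤ Set.indicator {t : ℝ | |t - a| < δ} 1 t := by
  by_cases ht : |t - a| < δ
  · rw [Set.indicator_of_mem (show t ∈ {t : ℝ | |t - a| < δ} from ht), Pi.one_apply]
    exact max_le zero_le_one (by linarith [div_nonneg (abs_nonneg (t - a)) hδ.le])
  · rw [Set.indicator_of_notMem (show t ∉ {t : ℝ | |t - a| < δ} from ht)]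
    refine max_le le_rfl ?_
    have : 1 ≤ |t - a| / δ := by rw [le_div_iff₀ hδ, one_mul]; exact not_lt.mp ht
    linarith

variable {G : Type*} [GaugeGroup G] [MeasurableSpace G] [HaarData G] [RegularGaugeGroup G] {ℰ : LoopAverage G} {γ : ℝ} {r w w' : ℕ → ℝ}

/-- **KING'S DEVICE ON EVENTS**: under `UnitTiltTail F ℰ γ r w w'` (summable non-negative rates) every measurable unit-field event `S` has, for all
`K ≥ K₀`, `μ_K(S) ≤ μ_{K₀}(S) + Σ_{i≥0} (8r + 4w + 2w′)(K₀ + i)` (`integral_unitLaw_sub_le_sum` on the indicator of `S`). [cite: King1986, Thm 3.4 (3.13) p.657] -/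
theorem measureReal_unitLaw_le_add_tail (hE : ℰ.MeasurableE) (hγ : 0 ≤ γ) (h : UnitTiltTail F ℰ γ r w w') (hr : Summable r)
    (hw : Summable w) (hw' : Summable w') {S : Set (GaugeField (F.P 0) 0 G)} (hS : MeasurableSet S) (K₀ : ℕ) :
    ∀ K, K₀ ≤ K → (F.unitLaw ℰ hE γ K).real S ≤
      (F.unitLaw ℰ hE γ K₀).real S + ∑' i, (8 * r (K₀ + i) + 4 * w (K₀ + i) + 2 * w' (K₀ + i)) := by
  obtain ⟨hr0, hw0, hw0'⟩ := nonneg_of_unitTiltTail h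
  intro K hK
  obtain ⟨d, rfl⟩ := Nat.exists_eq_add_of_le hK
  have hWm : Measurable (S.indicator (1 : GaugeField (F.P 0) 0 G → ℝ)) := measurable_one.indicator hS
  have hW1 : ∀ u, |S.indicator (1 : GaugeField (F.P 0) 0 G → ℝ) u| ≤ 1 := fun u => by
    by_cases hu : u ∈ S
    · rw [Set.indicator_of_mem hu]; simp
    · rw [Set.indicator_of_notMem hu]; simp
  have htele := integral_unitLaw_sub_le_sum hE hγ h hWm hW1 K₀ d
  rw [integral_indicator_one hS, integral_indicator_one hS] at htele
  have hδ : Summable fun i => 8 * r (K₀ + i) + 4 * w (K₀ + i) + 2 * w' (K₀ + i) :=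
    ((((summable_nat_add_iff K₀).mpr hr).mul_left 8).add (((summable_nat_add_iff K₀).mpr hw).mul_left 4)).add
      (((summable_nat_add_iff K₀).mpr hw').mul_left 2) |>.congr (fun i => by ring_nf)
  have hδ0 : ∀ i, 0 ≤ 8 * r (K₀ + i) + 4 * w (K₀ + i) + 2 * w' (K₀ + i) := fun i => by
    have := hr0 (K₀ + i); have := hw0 (K₀ + i); have := hw0' (K₀ + i); linarith
  have hpart : ∑ i ∈ Finset.range d, (8 * r (K₀ + i) + 4 * w (K₀ + i) + 2 * w' (K₀ + i)) ≤
      ∑' i, (8 * r (K₀ + i) + 4 * w (K₀ + i) + 2 * w' (K₀ + i)) :=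
    hδ.sum_le_tsum _ fun i _ => hδ0 i
  have := (abs_le.mp (htele.trans hpart)).2
  linarith

end Window

/-- No atom at `m` ⇒ windows around `m` of arbitrarily small mass (single-point continuity of a finite measure). [folklore] -/
private theorem exists_window_le {X : Type*} [MeasurableSpace X] (ν : Measure X) [IsFiniteMeasure ν] {W : X → ℝ} (hWm : Measurable W)
    (m : ℝ) (h0 : ν {u | W u = m} = 0) {ε : ℝ} (hε : 0 < ε) : ∃ δ : ℝ, 0 < δ ∧ ν.real {u | |W u - m| < δ} ≤ ε := by
  set s : ℕ → Set X := fun n => {u | |W u - m| < 1 / ((n : ℝ) + 1)} with hs_def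
  have hmeas : ∀ n, NullMeasurableSet (s n) ν := fun n =>
    (measurableSet_lt ((hWm.sub measurable_const).abs) measurable_const).nullMeasurableSet
  have hanti : Antitone s := by
    intro a b hab u hu
    simp only [hs_def, mem_setOf_eq] at hu ⊢
    have hab' : (a : ℝ) + 1 ≤ (b : ℝ) + 1 := by exact_mod_cast Nat.succ_le_succ hab
    exact hu.trans_le (one_div_le_one_div_of_le (by positivity) hab')
  have hI : (⋂ n, s n) = {u | W u = m} := by
    ext u
    simp only [mem_iInter, hs_def, mem_setOf_eq]
    constructor
    · intro hu
      by_contra hne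
      have hpos : 0 < |W u - m| := abs_pos.mpr (sub_ne_zero.mpr hne)
      obtain ⟨n, hn⟩ := exists_nat_one_div_lt hpos
      exact (lt_irrefl _) ((hu n).trans hn)
    · intro hu n
      rw [hu, sub_self, abs_zero]
      positivity
  have hlim := tendsto_measure_iInter_atTop hmeas hanti ⟨0, measure_ne_top _ _⟩
  rw [hI, h0] at hlim
  have hev : ∀ᶠ n in atTop, ν (s n) < ENNReal.ofReal ε := hlim.eventually (gt_mem_nhds (by simpa using hε))
  obtain ⟨n, hn⟩ := hev.exists
  exact ⟨1 / ((n : ℝ) + 1), by positivity, ENNReal.toReal_le_of_le_ofReal hε.le hn.le⟩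

/-! ## §3 The limit law has no atoms along any once-visiting label -/

section Atomless

variable {r w w' : ℕ → ℝ}

/-- **THE CONTINUUM LOOP LAW IS ATOMLESS ALONG EVERY ONCE-VISITING LABEL** (from a refinement's tilt, `SU(2)`, printed averaging, `γ ≥ 0`):
if `UnitTiltTail (F.refine n) ℰp (γL^{-n}) r w w'` holds with summable rates and `ν` is the weak limit of the loop laws of `(F, γ)`, then
`ν{y | y_C = a} = 0` for every `a` and every label `C` whose unit-lattice representative visits some bond exactly once.  Proof: tent function ≤
window indicator; one-observable refinement identity; King's device on the window event from a late `K₀`; no atom under `μ_{K₀}`; `δ → 0`, `K₀ → ∞`.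
[cite: King1986, Thm 3.4 (3.13) p.657] -/
theorem limitLaw_apply_level_eq_zero_of_refine_unitTiltTail (F : T3Family) (n : ℕ) {γ : ℝ} (hγ : 0 ≤ γ)
    (h : UnitTiltTail (F.refine n) ℰp (γ * ((F.L : ℝ)⁻¹) ^ n) r w w') (hr : Summable r) (hw : Summable w) (hw' : Summable w')
    {ν : ProbabilityMeasure (Cube (ULoop3 F))} (hν : Tendsto (loopLaw F (F.avgMeasurable_of_measurableE ℰp measurableE_ℰp) hγ) atTop (𝓝 ν))
    (C : ULoop3 F) (γ₁ γ₂ : List (LStep (F.P 0) 0)) (s : LStep (F.P 0) 0) (hC : C.1.atLevel 0 = γ₁ ++ s :: γ₂)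
    (h₁ : ∀ s' ∈ γ₁, s'.bond ≠ s.bond) (h₂ : ∀ s' ∈ γ₂, s'.bond ≠ s.bond) (a : ℝ) :
    (ν : Measure (Cube (ULoop3 F))) {y | ((y C : Set.Icc (-1 : ℝ) 1) : ℝ) = a} = 0 := by
  have hγ' : 0 ≤ γ * ((F.L : ℝ)⁻¹) ^ n := mul_nonneg hγ (pow_nonneg (inv_nonneg.mpr (Nat.cast_nonneg _)) _)
  -- notation
  set μ : ℕ → Measure (GaugeField ((F.refine n).P 0) 0 (Matrix.specialUnitaryGroup (Fin 2) ℂ)) :=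
    fun K => (F.refine n).unitLaw ℰp measurableE_ℰp (γ * ((F.L : ℝ)⁻¹) ^ n) K with hμ_def
  haveI hP : ∀ K, IsProbabilityMeasure (μ K) := fun K => isProbabilityMeasure_unitLaw measurableE_ℰp hγ' K
  set V : GaugeField ((F.refine n).P 0) 0 (Matrix.specialUnitaryGroup (Fin 2) ℂ) → ℝ := coarseObs F n ℰp [C] with hV_def
  have hVm : Measurable V := measurable_coarseObs F n ℰp measurableE_ℰp [C]
  set T : ℕ → ℝ := fun K₀ => ∑' i, (8 * r (K₀ + i) + 4 * w (K₀ + i) + 2 * w' (K₀ + i)) with hT_def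
  -- the tail `T K₀ → 0`
  have hT : Tendsto T atTop (𝓝 0) :=
    (tendsto_sum_nat_add fun k => 8 * r k + 4 * w k + 2 * w' k).congr fun K₀ => tsum_congr fun i => by rw [add_comm i K₀]
  -- the window events upstairs and the atom set downstairs
  set Sδ : ℝ → Set (GaugeField ((F.refine n).P 0) 0 (Matrix.specialUnitaryGroup (Fin 2) ℂ)) := fun δ => {u | |V u - a| < δ}
    with hSδ_def
  have hSm : ∀ δ, MeasurableSet (Sδ δ) := fun δ => measurableSet_lt ((hVm.sub measurable_const).abs) measurable_const
  set A : Set (Cube (ULoop3 F)) := {y | ((y C : Set.Icc (-1 : ℝ) 1) : ℝ) = a} with hA_def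
  have hAm : MeasurableSet A := (measurable_subtype_coe.comp (measurable_pi_apply C)) (measurableSet_singleton a)
  -- STEP 1: for every `δ > 0` and `K₀`: `ν(A) ≤ μ_{K₀}(S_δ) + T K₀`
  have hstep : ∀ (δ : ℝ), 0 < δ → ∀ K₀ : ℕ, (ν : Measure (Cube (ULoop3 F))).real A ≤ (μ K₀).real (Sδ δ) + T K₀ := by
    intro δ hδ K₀
    -- the tent of half-width `δ` around `a` on the `C`-coordinate: continuous, in `[0,1]`, `= 1` on `A`, `≤ 𝟙{|y_C − a| < δ}`
    let tent : Cube (ULoop3 F) →ᵇ ℝ := BoundedContinuousFunction.mkOfCompact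
      ⟨fun y => max 0 (1 - |((y C : Set.Icc (-1 : ℝ) 1) : ℝ) - a| / δ),
        continuous_const.max (continuous_const.sub
          (((continuous_subtype_val.comp (continuous_apply C)).sub continuous_const).abs.div_const δ))⟩
    have tent_apply : ∀ y, tent y = max 0 (1 - |((y C : Set.Icc (-1 : ℝ) 1) : ℝ) - a| / δ) := fun y => rfl
    -- (i) `ν(A) ≤ ∫ tent dν`
    have hint_ν : (ν : Measure (Cube (ULoop3 F))).real A ≤ ∫ y, tent y ∂(ν : Measure (Cube (ULoop3 F))) := by
      rw [← integral_indicator_one hAm]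
      refine integral_mono ((integrable_const (1 : ℝ)).indicator hAm) (tent.integrable _) fun y => ?_
      by_cases hy : y ∈ A
      · rw [Set.indicator_of_mem hy, Pi.one_apply, tent_apply]
        have hya : ((y C : Set.Icc (-1 : ℝ) 1) : ℝ) - a = 0 := sub_eq_zero.mpr hy
        rw [hya, abs_zero, zero_div, sub_zero, max_eq_right zero_le_one]
      · rw [Set.indicator_of_notMem hy]
        exact (by rw [tent_apply]; exact le_max_left _ _)
    -- (ii) `∫ tent d(loopLaw (K+n)) = ∫ tent(V) dμ_K ≤ μ_K(S_δ)`
    have hlaw : ∀ K, ∫ y, tent y ∂(loopLaw F (F.avgMeasurable_of_measurableE ℰp measurableE_ℰp) hγ (K + n) :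
        Measure (Cube (ULoop3 F))) ≤ (μ K).real (Sδ δ) := by
      intro K
      have h1 : ∀ K' o U, |(F.scheme ℰp γ).obs K' o U| ≤ 1 := fun K' o U => F.abs_avgObs_le_one ℰp K' o U
      have hrw : ∫ y, tent y ∂(loopLaw F (F.avgMeasurable_of_measurableE ℰp measurableE_ℰp) hγ (K + n) :
          Measure (Cube (ULoop3 F))) = ∫ u, max 0 (1 - |V u - a| / δ) ∂μ K := by
        rw [loopLaw, toMeasure_law, integral_map (measurable_obsVec _ (fun K C =>
          F.measurable_avgObs (F.avgMeasurable_of_measurableE ℰp measurableE_ℰp) K C) (K + n)).aemeasurable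
          tent.continuous.aestronglyMeasurable]
        simp only [tent_apply, coe_obsVec_apply _ h1]
        exact integral_comp_avgObs_refine F n ℰp measurableE_ℰp hγ K C
          ((continuous_const.max (continuous_const.sub ((continuous_id.sub continuous_const).abs.div_const δ))).measurable)
      rw [hrw, ← integral_indicator_one (hSm δ)]
      have hgm : Measurable fun u => max 0 (1 - |V u - a| / δ) :=
        measurable_const.max (measurable_const.sub (((hVm.sub measurable_const).abs).div_const δ))
      have hgi : Integrable (fun u => max 0 (1 - |V u - a| / δ)) (μ K) :=
        (integrable_const (1 : ℝ)).mono' hgm.aestronglyMeasurable (ae_of_all _ fun u => by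
          rw [Real.norm_eq_abs, abs_of_nonneg (le_max_left _ _)]
          exact max_le zero_le_one (by linarith [div_nonneg (abs_nonneg (V u - a)) hδ.le]))
      exact integral_mono hgi ((integrable_const (1 : ℝ)).indicator (hSm δ)) fun u => tentFun_le_indicator hδ (V u)
    -- (iii) King's device on the window event, from `K₀` on
    have hking := measureReal_unitLaw_le_add_tail (F := F.refine n) measurableE_ℰp hγ' h hr hw hw' (hSm δ) K₀
    -- (iv) the weak limit along `K + n`
    have hlim : Tendsto (fun K => ∫ y, tent y ∂(loopLaw F (F.avgMeasurable_of_measurableE ℰp measurableE_ℰp) hγ K :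
        Measure (Cube (ULoop3 F)))) atTop (𝓝 (∫ y, tent y ∂(ν : Measure (Cube (ULoop3 F))))) :=
      (ProbabilityMeasure.tendsto_iff_forall_integral_tendsto.mp hν) tent
    have hlim' := (tendsto_add_atTop_iff_nat n).mpr hlim
    have hev : ∀ᶠ K in atTop, ∫ y, tent y ∂(loopLaw F (F.avgMeasurable_of_measurableE ℰp measurableE_ℰp) hγ (K + n) :
        Measure (Cube (ULoop3 F))) ≤ (μ K₀).real (Sδ δ) + T K₀ :=
      eventually_atTop.2 ⟨K₀, fun K hK => (hlaw K).trans (hking K hK)⟩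
    exact hint_ν.trans (le_of_tendsto hlim' hev)
  -- STEP 2: `δ → 0` at fixed `K₀` (no atom of `V` at `a` under `μ_{K₀}`), then `K₀ → ∞`
  have hK₀ : ∀ K₀ : ℕ, (ν : Measure (Cube (ULoop3 F))).real A ≤ T K₀ := by
    intro K₀
    have hat : (μ K₀) {u | V u = a} = 0 := refine_unitLaw_coarseLevel_eq_zero_of_split F n hγ' K₀ C γ₁ γ₂ s hC h₁ h₂ a
    refine le_of_forall_pos_le_add fun ε hε => ?_
    obtain ⟨δ, hδ, hwin⟩ := exists_window_le (μ K₀) hVm a hat hε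
    have := hstep δ hδ K₀
    linarith
  have hle0 : (ν : Measure (Cube (ULoop3 F))).real A ≤ 0 := ge_of_tendsto' hT hK₀
  have hreal : (ν : Measure (Cube (ULoop3 F))).real A = 0 := le_antisymm hle0 measureReal_nonneg
  exact (measureReal_eq_zero_iff (measure_ne_top _ _)).mp hreal

/-- **PACKAGED: THE OS CONTINUUM LAW OF `(F, γ)` FROM A REFINEMENT'S TILT IS ATOMLESS ALONG EVERY ONCE-VISITING LABEL** (with existence,
uniqueness, centre symmetry and non-degeneracy from `T3OSLawNontrivial`). [cite: JaffeWittenClay2006, §6.5 p.11] -/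
theorem exists_osLaw_atomless_of_refine_unitTiltTail (F : T3Family) (n : ℕ) {γ : ℝ} (hγ : 0 ≤ γ)
    (h : UnitTiltTail (F.refine n) ℰp (γ * ((F.L : ℝ)⁻¹) ^ n) r w w') (hr : Summable r) (hw : Summable w) (hw' : Summable w') :
    ∃ ν : ProbabilityMeasure (Cube (ULoop3 F)), IsOSContinuumLaw3 F measurableE_ℰp hγ ν ∧
      ∀ (C : ULoop3 F) (γ₁ γ₂ : List (LStep (F.P 0) 0)) (s : LStep (F.P 0) 0), C.1.atLevel 0 = γ₁ ++ s :: γ₂ →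
        (∀ s' ∈ γ₁, s'.bond ≠ s.bond) → (∀ s' ∈ γ₂, s'.bond ≠ s.bond) →
          ∀ a : ℝ, (ν : Measure (Cube (ULoop3 F))) {y | ((y C : Set.Icc (-1 : ℝ) 1) : ℝ) = a} = 0 := by
  obtain ⟨ν, hν, -, -, -⟩ := exists_osLaw_nontrivial_of_refine_unitTiltTail F n hγ h hr hw hw'
  exact ⟨ν, hν, fun C γ₁ γ₂ s hC h₁ h₂ a =>
    limitLaw_apply_level_eq_zero_of_refine_unitTiltTail F n hγ h hr hw hw' hν.1 C γ₁ γ₂ s hC h₁ h₂ a⟩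

end Atomless

end Literature.MathematicalPhysics.QuantumFieldTheory.Balaban1983to89.T3LimitLawAtomless

end
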